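import Summits.CriticalPhenomena.PercolationContinuityZ3.Theorems.PercNearOneGluingNoHeavyLowerTailOneCutCertSound
import HarnessLib

/-!
# The apex-pair row APL at the sharp constant `2/3` by a MULTIPLIER-FREE two-copy certificate:
# the Kronecker fibre checker `aplCheck` and its soundness

builds on p205010 (kernel theorem, internal audit signed; external expert review pending)

Support file (`--supports stmt-CriticalPhenomena-4575`), seat `prim-cert-1` (gen 11); memo
`run/shared/lean/prim/prim-cert-1/FROM-prim-cert-1-g11-FIBRE-APL.md`.  No sorries, standard axioms; nothing here asserts anything
about APL itself (the instance files evaluate the checker by `native_decide`).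

SETTING.  Finite weighted graph on `Fin n` (`prodBernoulli w`, events `openConn`), apex `a`, targets `b, c`.  The lineage's
reverse-Harris row APL (prim-ineq-gen-8 g8–g30, prim-ineq-prove-5 g35–37; needed with any constant `> 0.2046` by
`ThreePort.pocketExchange_of_apl` for `Z(3,2)` at three-port observers; conjectured sharp constant `2/3`) in its strongest "Φ" form reads
`3·e ≥ 2·D·T`, `e = P(a joined to EXACTLY ONE of b, c)`, `D = P(b ↮ c)`, `T = P(a ↔ b ∨ a ↔ c)`.  It is of bidegree `(1, 2)` in the law, so
its two-copy (degree-2 Bernstein) expansion in the edge weights has one coefficient per fibre `k : Fin m → Fin 3`; the coefficient is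
`certCoefZ Λ T C H k` of prim-cert-2's certificate algebra with the FIXED tables `Λ ≡ 1`, `T = 3·1[a ↔ exactly one]`, `C = 1[a ↔ b ∨ a ↔ c]`,
`H = 2·1[b ↮ c]` — no certificate data at all.  `aplCheck n a b c s` computes all `3^m` coefficients at once as the base-`2^s` digits of one
Kronecker product (`krN`, `krZ`, AND-mask digit test, exactly as in `OneCutCert.boxCheck` / `FarKron.farCheck`) and accepts iff they are
all `≥ 0`; `aplCheck_sound` turns acceptance into `2·D·T ≤ 3·e` for EVERY weight vector (closed cube: no normalisation is needed, so no
genericity / limit argument either).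

* `AplKron.exactlyOne a b c` — the event `{a ↔ b} Δ {a ↔ c}`;
* `AplKron.aplCheck`, `AplKron.aplCheck_sound`.
-/

namespace Summit.CriticalPhenomena.PercolationContinuityZ3.Theorems.AplKron

open Finset MeasureTheory
open scoped BigOperators
open Literature.Probability.Percolation Literature.Probability.LatticeModels
open Summit.CriticalPhenomena.PercolationContinuityZ3.Theorems.AdditiveGluing.Negative.Cert
open Summit.CriticalPhenomena.PercolationContinuityZ3.Theorems.OneCutCert
open scoped Classical

variable {n : ℕ}

/-! ## The event and the raw tables -/

/-- The event "`a` is joined to exactly one of `b`, `c`": `{a ↔ b} Δ {a ↔ c}`. [this work] -/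
def exactlyOne (a b c : Fin n) : Set (BondConfig (Fin n)) :=
  {ω | (ω ∈ openConn a b ∧ ω ∉ openConn a c) ∨ (ω ∉ openConn a b ∧ ω ∈ openConn a c)}

/-- Reach bit of a reach table. [this work] -/
def rch (rt : List ℕ) (x y : Fin n) : Bool := (rt.getD x 0).testBit y

/-- Table entry `3·1[a ↔ exactly one of b, c]` from a reach table. [this work] -/
def oneOfRT (a b c : Fin n) (rt : List ℕ) : ℤ := if (rch rt a b != rch rt a c) = true then 3 else 0

/-- Table entry `2·1[b ↮ c]` from a reach table. [this work] -/
def dOfRT (b c : Fin n) (rt : List ℕ) : ℤ := if rch rt b c = true then 0 else 2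

/-- Table entry `1[a ↔ b ∨ a ↔ c]` from a reach table. [this work] -/
def tOfRT (a b c : Fin n) (rt : List ℕ) : ℕ := if (rch rt a b || rch rt a c) = true then 1 else 0

/-- Raw integer table of `3·1[a ↔ exactly one of b, c]`, indexed by bitmask. [this work] -/
def rawOne (n : ℕ) (a b c : Fin n) : List ℤ :=
  (List.range (2 ^ mE n)).map fun m => oneOfRT a b c (reachTable n (cfgM n m))

/-- Raw integer table of `2·1[b ↮ c]`, indexed by bitmask. [this work] -/
def rawD (n : ℕ) (b c : Fin n) : List ℤ :=
  (List.range (2 ^ mE n)).map fun m => dOfRT b c (reachTable n (cfgM n m))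

/-- Raw table of `1[a ↔ b ∨ a ↔ c]` (naturals), indexed by bitmask. [this work] -/
def rawT (n : ℕ) (a b c : Fin n) : List ℕ :=
  (List.range (2 ^ mE n)).map fun m => tOfRT a b c (reachTable n (cfgM n m))

/-- The all-ones multiplier table. [this work] -/
def ones (n : ℕ) : List ℕ := List.replicate (2 ^ mE n) 1

/-- Length of `rawOne`. [this work] -/
theorem length_rawOne (a b c : Fin n) : (rawOne n a b c).length = 2 ^ mE n := by simp [rawOne]

/-- Length of `rawD`. [this work] -/
theorem length_rawD (b c : Fin n) : (rawD n b c).length = 2 ^ mE n := by simp [rawD]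

/-- Length of `rawT`. [this work] -/
theorem length_rawT (a b c : Fin n) : (rawT n a b c).length = 2 ^ mE n := by simp [rawT]

/-- Length of `ones`. [this work] -/
theorem length_ones : (ones n).length = 2 ^ mE n := by simp [ones]

/-- `rch` of the reach table of a corner is `connB`. [this work] -/
theorem rch_reachTable_cfg (g : Fin (mE n) → Bool) (x y : Fin n) : rch (reachTable n (cfg g)) x y = connB g x y := rfl

/-- Entries of `rawOne`. [this work] -/
theorem tabOf_rawOne (a b c : Fin n) (g : Fin (mE n) → Bool) :
    tabOf (rawOne n a b c) g = if (connB g a b != connB g a c) = true then 3 else 0 := by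
  unfold tabOf rawOne oneOfRT
  rw [List.getD_eq_getElem?_getD, List.getElem?_map, List.getElem?_range (enc2_lt g)]
  simp only [Option.map_some, Option.getD_some, cfgM_enc2, rch_reachTable_cfg]

/-- Entries of `rawD`. [this work] -/
theorem tabOf_rawD (b c : Fin n) (g : Fin (mE n) → Bool) :
    tabOf (rawD n b c) g = if connB g b c = true then 0 else 2 := by
  unfold tabOf rawD dOfRT
  rw [List.getD_eq_getElem?_getD, List.getElem?_map, List.getElem?_range (enc2_lt g)]
  simp only [Option.map_some, Option.getD_some, cfgM_enc2, rch_reachTable_cfg]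

/-- Entries of `rawT` (cast to `ℤ`). [this work] -/
theorem tabOf_rawT (a b c : Fin n) (g : Fin (mE n) → Bool) :
    tabOf ((rawT n a b c).map ((↑) : ℕ → ℤ)) g = if (connB g a b || connB g a c) = true then 1 else 0 := by
  unfold tabOf rawT tOfRT
  rw [List.getD_eq_getElem?_getD, List.getElem?_map, List.getElem?_map, List.getElem?_range (enc2_lt g)]
  simp only [Option.map_some, Option.getD_some, cfgM_enc2, rch_reachTable_cfg]
  split_ifs <;> simp

/-- Entries of `ones` (cast to `ℤ`). [this work] -/
theorem tabOf_ones (g : Fin (mE n) → Bool) : tabOf ((ones n).map ((↑) : ℕ → ℤ)) g = 1 := by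
  unfold tabOf ones
  rw [List.getD_eq_getElem?_getD, List.getElem?_map, List.getElem?_replicate, if_pos (enc2_lt g)]
  simp

/-! ## The three events as multilinear polynomials of the weights -/

/-- **Table of the exactly-one event**: `P_w({a ↔ b} Δ {a ↔ c}) = ML 1[connB a b ≠ connB a c] (xOf w)`. [this work] -/
theorem real_exactlyOne_eq_ML (w : Sym2 (Fin n) → unitInterval) (a b c : Fin n) :
    (prodBernoulli w).real (exactlyOne a b c)
      = ML (fun g => if (connB g a b != connB g a c) = true then 1 else 0) (xOf w) := by
  classical
  have hB : ∀ ω ω' : Set (Sym2 (Fin n)), openGraph ω = openGraph ω' →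
      (ω ∈ exactlyOne a b c ↔ ω' ∈ exactlyOne a b c) := by
    intro ω ω' h
    simp only [exactlyOne, Set.mem_setOf_eq, openConn_of_openGraph a b ω ω' h, openConn_of_openGraph a c ω ω' h]
  rw [real_eq_ML w _ hB]
  congr 1
  funext g
  unfold evT
  simp only [exactlyOne, Set.mem_setOf_eq, ← connB_iff]
  cases connB g a b <;> cases connB g a c <;> simp

/-- **Table of the union event**: `P_w({a ↔ b} ∪ {a ↔ c}) = ML 1[connB a b ∨ connB a c] (xOf w)`. [this work] -/
theorem real_union_eq_ML (w : Sym2 (Fin n) → unitInterval) (a b c : Fin n) :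
    (prodBernoulli w).real (openConn a b ∪ openConn a c)
      = ML (fun g => if (connB g a b || connB g a c) = true then 1 else 0) (xOf w) := by
  classical
  have hB : ∀ ω ω' : Set (Sym2 (Fin n)), openGraph ω = openGraph ω' →
      (ω ∈ (openConn a b ∪ openConn a c : Set (BondConfig (Fin n))) ↔
       ω' ∈ (openConn a b ∪ openConn a c : Set (BondConfig (Fin n)))) := by
    intro ω ω' h
    simp only [Set.mem_union, openConn_of_openGraph a b ω ω' h, openConn_of_openGraph a c ω ω' h]
  rw [real_eq_ML w _ hB]
  congr 1
  funext g
  unfold evT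
  simp only [Set.mem_union, ← connB_iff]
  cases connB g a b <;> cases connB g a c <;> simp

/-! ## The checker -/

/-- The multiplier-free two-copy CHECK of `3·e ≥ 2·D·T` at apex `a`, targets `b, c` on `Fin n` (all `mE n` pair weights free),
base `2^s`: all `3^m` Bernstein (fibre) coefficients of `ML 1 · ML (3·1[exactly one]) − ML 1[a↔b ∨ a↔c] · ML (2·1[b↮c])` are `≥ 0`.
COMPUTATIONAL when evaluated; meant for `native_decide` in instance files. [this work] -/
def aplCheck (n : ℕ) (a b c : Fin n) (s : ℕ) : Bool :=
  let m := mE n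
  let Tl : List ℤ := rawOne n a b c
  let Hl : List ℤ := rawD n b c
  let lam : List ℕ := ones n
  let cc : List ℕ := rawT n a b c
  let Z : ℤ := (krN s m lam : ℤ) * krZ s m Tl - (krN s m cc : ℤ) * krZ s m Hl
  let off : ℤ := 2 ^ (s - 1) * (((2 : ℤ) ^ (s * 3 ^ m) - 1) / (2 ^ s - 1))
  let bnd : ℕ := 2 ^ m * (maxNat lam * maxAbs Tl + maxNat cc * maxAbs Hl)
  decide (0 < s) && decide (bnd < 2 ^ (s - 1))
    && decide (0 ≤ Z + off) && decide (((Z + off).toNat &&& off.toNat) = off.toNat)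

/-! ## Soundness -/

set_option maxHeartbeats 800000 in
/-- **Soundness of the APL fibre check.**  If `aplCheck n a b c s` accepts then, for EVERY weight vector `w` on `Fin n`,
`2 · P(b ↮ c) · P(a ↔ b ∨ a ↔ c) ≤ 3 · P(a ↔ exactly one of b, c)` — the reverse-Harris row APL in its Φ-form at the
constant `2/3` (hence `P(a ↔ exactly one) ≥ (2/3)·P(a|b|c)·P(abc)`, APL₁(2/3)).  [this work] -/
theorem aplCheck_sound (a b c : Fin n) (s : ℕ) (hc : aplCheck n a b c s = true)
    (w : Sym2 (Fin n) → unitInterval) :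
    2 * ((prodBernoulli w).real (openConn b c)ᶜ * (prodBernoulli w).real (openConn a b ∪ openConn a c))
      ≤ 3 * (prodBernoulli w).real (exactlyOne a b c) := by
  -- unpack the check
  unfold aplCheck at hc
  simp only [Bool.and_eq_true, decide_eq_true_eq] at hc
  obtain ⟨⟨⟨hs, hbnd⟩, hZoff⟩, hland⟩ := hc
  -- the tables
  let Tl : List ℤ := rawOne n a b c
  let Hl : List ℤ := rawD n b c
  let Λ : Fin 1 → (Fin (mE n) → Bool) → ℤ := fun _ => tabOf ((ones n).map ((↑) : ℕ → ℤ))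
  let T : Fin 1 → (Fin (mE n) → Bool) → ℤ := fun _ => tabOf Tl
  let C : (Fin (mE n) → Bool) → ℤ := tabOf ((rawT n a b c).map ((↑) : ℕ → ℤ))
  let H : (Fin (mE n) → Bool) → ℤ := tabOf Hl
  have hTlen : Tl.length = 2 ^ mE n := length_rawOne a b c
  have hHlen : Hl.length = 2 ^ mE n := length_rawD b c
  have hlamlen : (ones n).length = 2 ^ mE n := length_ones
  have hcc : (rawT n a b c).length = 2 ^ mE n := length_rawT a b c
  -- Step A: all integer fibre sums are nonnegative
  have hmaxNat : ∀ l : List ℕ, (maxAbs (l.map ((↑) : ℕ → ℤ)) : ℤ) = (maxNat l : ℤ) := fun l => by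
    rw [maxAbs_map_natCast]; rfl
  have hA : ∀ k, 0 ≤ certCoefZ Λ T C H k := by
    have hoff : ((2 : ℤ) ^ (s - 1) * ((2 ^ (s * 3 ^ mE n) - 1) / (2 ^ s - 1))) = (maskN s (3 ^ mE n) : ℤ) := by
      rw [off_eq s _ hs, Finset.mul_sum, maskN_eq_sum s hs]
    rw [hoff, Int.toNat_natCast] at hland
    rw [hoff] at hZoff
    refine certCoefZ_nonneg_of_digit_ge hs ?_ ((_ : ℤ) + _).toNat ?_
      (fun j hj => digit_ge_of_land s hs (3 ^ mE n) _ hland j hj)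
    · -- coefficient bound
      intro k
      have h1 : |certCoefZ Λ T C H k| ≤
          ∑ _q : Fin 1, 2 ^ mE n * ((maxAbs ((ones n).map ((↑) : ℕ → ℤ)) : ℤ) * maxAbs Tl) +
            2 ^ mE n * ((maxAbs ((rawT n a b c).map ((↑) : ℕ → ℤ)) : ℤ) * maxAbs Hl) := by
        unfold certCoefZ
        refine (abs_sub _ _).trans (add_le_add ((Finset.abs_sum_le_sum_abs _ _).trans
          (Finset.sum_le_sum fun q _ => abs_pcoef_le _ _ k)) (abs_pcoef_le _ _ k))
      have h2 : (∑ _q : Fin 1, 2 ^ mE n * ((maxAbs ((ones n).map ((↑) : ℕ → ℤ)) : ℤ) * maxAbs Tl) +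
            2 ^ mE n * ((maxAbs ((rawT n a b c).map ((↑) : ℕ → ℤ)) : ℤ) * maxAbs Hl) : ℤ) =
          ((2 ^ mE n * (maxNat (ones n) * maxAbs Tl + maxNat (rawT n a b c) * maxAbs Hl) : ℕ) : ℤ) := by
        rw [Fin.sum_univ_one]
        push_cast
        simp only [hmaxNat, mul_add]
      rw [h2] at h1
      exact lt_of_le_of_lt h1 (by exact_mod_cast hbnd)
    · -- the number
      rw [Int.toNat_of_nonneg hZoff]
      congr 1
      · unfold certZ
        rw [Fin.sum_univ_one]
        congr 1
        · rw [krN_eq s (mE n) _ hlamlen, krZ_eq s _ hTlen]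
        · rw [krN_eq s (mE n) _ hcc, krZ_eq s _ hHlen]
      · rw [maskN_eq_sum s hs, Finset.sum_range]
  -- Step B: the certificate form is nonnegative at `xOf w` (closed cube)
  have hF : 0 ≤ certForm (fun k g => (Λ k g : ℝ)) (fun k g => (T k g : ℝ)) (fun g => (C g : ℝ))
      (fun g => (H g : ℝ)) (xOf w) :=
    certForm_nonneg (fun k => by rw [certCoef_cast]; exact_mod_cast hA k) (inCube_xOf w)
  -- Step C: identify the four factors
  set μ := prodBernoulli w with hμ
  have hΛ : ∀ k : Fin 1, ML (fun g => (Λ k g : ℝ)) (xOf w) = 1 := by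
    intro k
    have e1 : (fun g => (Λ k g : ℝ)) = fun _ => (1 : ℝ) := by
      funext g
      show ((tabOf ((ones n).map ((↑) : ℕ → ℤ)) g : ℤ) : ℝ) = 1
      rw [tabOf_ones]; simp
    rw [e1, ML_const]
  have hT : ∀ k : Fin 1, ML (fun g => (T k g : ℝ)) (xOf w) = 3 * μ.real (exactlyOne a b c) := by
    intro k
    have e1 : (fun g => (T k g : ℝ)) = fun g =>
        3 * (if (connB g a b != connB g a c) = true then (1 : ℝ) else 0) := by
      funext g
      show ((tabOf (rawOne n a b c) g : ℤ) : ℝ) = _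
      rw [tabOf_rawOne]
      split_ifs <;> simp
    rw [e1, ML_smul, ← real_exactlyOne_eq_ML]
  have hC : ML (fun g => (C g : ℝ)) (xOf w) = μ.real (openConn a b ∪ openConn a c) := by
    have e1 : (fun g => (C g : ℝ)) = fun g => (if (connB g a b || connB g a c) = true then (1 : ℝ) else 0) := by
      funext g
      show ((tabOf ((rawT n a b c).map ((↑) : ℕ → ℤ)) g : ℤ) : ℝ) = _
      rw [tabOf_rawT]
      split_ifs <;> simp
    rw [e1, ← real_union_eq_ML]
  have hH : ML (fun g => (H g : ℝ)) (xOf w) = 2 * μ.real (openConn b c)ᶜ := by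
    have e1 : (fun g => (H g : ℝ)) = fun g => 2 * (if connB g b c = true then (0 : ℝ) else 1) := by
      funext g
      show ((tabOf (rawD n b c) g : ℤ) : ℝ) = _
      rw [tabOf_rawD]
      split_ifs <;> simp
    rw [e1, ML_smul, ← real_sep_eq_ML]
  -- Step D: conclude
  have hform : certForm (fun k g => (Λ k g : ℝ)) (fun k g => (T k g : ℝ)) (fun g => (C g : ℝ))
      (fun g => (H g : ℝ)) (xOf w)
      = 3 * μ.real (exactlyOne a b c) - μ.real (openConn a b ∪ openConn a c) * (2 * μ.real (openConn b c)ᶜ) := by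
    unfold certForm
    rw [Fin.sum_univ_one, hΛ 0, hT 0, hC, hH, one_mul]
  rw [hform] at hF
  linarith

end Summit.CriticalPhenomena.PercolationContinuityZ3.Theorems.AplKron
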